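import Literature.Analysis.FluidPDE.Tao2016AveragedNS.LocalCascadeSolutions

/-!
# `WakeRatchet.EternalViscousRate` (stmt-NavierStokesRegularity-25647): ZERO-PADDING PRESERVES TAO'S CLASS `E₂(R)`
# and commutes with the pump dictionary — brick 4c of the bridge «`PerpetualPump.CircuitPump` witness ⟹
# dissipation-balanced block-DSS bounded admissible eternal solution on a `Fin 4` table of Tao's class»

Companion of `…CircuitPumpPad` (padding of witnesses in the pump encoding) and `…CircuitPumpTodaClass` (the m = 2 pulled-back
Toda table ∈ `InTableClass (2/ε)`): (i) `inTableClass_pad` — zero-padding a `Fin m` table of Tao's class by `k` inert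
components (nested `Fin.append` with zero rows, no new definition) stays in `InTableClass R` (symmetry (4.2), cancellation
(4.3), comparability are entrywise and the new entries are `0`); (ii) `pullback_pad_comm` — the dictionary of
`…CircuitPumpTable` (`Option (Fin 3)` shift labels ↦ Tao's shift set) commutes with padding, so the pulled-back table of a
padded pump witness IS the padded pulled-back table.  Consequently the `m = 2 ⊂ 4` padding of the perpetual pump's table is a
member of `E₂(2/ε)` on `Fin 4` (cf. the tree's explicit `T_ε`, `WakeRatchetSeededToda.inTableClass_seededToda`, p817230).
HONEST LABEL: finite bookkeeping about MODEL lattice tables (Tao 2016 §4); no item is closed; nothing here bears on the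
Navier–Stokes equations.
-/

set_option linter.dupNamespace false

noncomputable section

open scoped BigOperators

namespace Summit.NavierStokesRegularity.NavierStokesRegularity.Theorems.WakeRatchetCircuitPumpPadClass

open Literature.Analysis.FluidPDE Literature.Analysis.FluidPDE.TaoCascade

variable {m k : ℕ}

/-- **Zero-padding preserves `E₂(R)`.**  If `α` is symmetric, cancelling and `R`-comparable on `Fin m`, so is its padding by
`k` inert components (all entries with a new index vanish).
[cite: Tao2016AveragedNS, §4 (4.2)–(4.3), §6.1 (comparable tables); elementary] -/
theorem inTableClass_pad {R : ℝ} {α : Fin m → Fin m → Fin m → ℤ × ℤ × ℤ → ℝ} (h : InTableClass R α) :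
    InTableClass R
      (Fin.append (fun i₁ : Fin m => Fin.append (fun i₂ : Fin m => Fin.append (α i₁ i₂)
          (fun (_ : Fin k) (_ : ℤ × ℤ × ℤ) => (0 : ℝ)))
        (fun (_ : Fin k) (_ : Fin (m + k)) (_ : ℤ × ℤ × ℤ) => (0 : ℝ)))
        (fun (_ : Fin k) (_ : Fin (m + k)) (_ : Fin (m + k)) (_ : ℤ × ℤ × ℤ) => (0 : ℝ))) := by
  obtain ⟨hS, hC, hK⟩ := h
  refine ⟨?_, ?_, ?_⟩
  · intro j₁ j₂ j₃ μ₁ μ₂ μ₃ hμ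
    refine Fin.addCases (fun i₁ => ?_) (fun l₁ => ?_) j₁ <;>
    refine Fin.addCases (fun i₂ => ?_) (fun l₂ => ?_) j₂ <;>
    refine Fin.addCases (fun i₃ => ?_) (fun l₃ => ?_) j₃ <;>
    simp only [Fin.append_left, Fin.append_right]
    exact hS i₁ i₂ i₃ μ₁ μ₂ μ₃ hμ
  · intro j₁ j₂ j₃ μ₁ μ₂ μ₃ hμ
    refine Fin.addCases (fun i₁ => ?_) (fun l₁ => ?_) j₁ <;>
    refine Fin.addCases (fun i₂ => ?_) (fun l₂ => ?_) j₂ <;>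
    refine Fin.addCases (fun i₃ => ?_) (fun l₃ => ?_) j₃ <;>
    simp only [Fin.append_left, Fin.append_right, add_zero]
    exact hC i₁ i₂ i₃ μ₁ μ₂ μ₃ hμ
  · intro j₁ j₂ j₃ μ hμ
    refine Fin.addCases (fun i₁ => ?_) (fun l₁ => ?_) j₁ <;>
    refine Fin.addCases (fun i₂ => ?_) (fun l₂ => ?_) j₂ <;>
    refine Fin.addCases (fun i₃ => ?_) (fun l₃ => ?_) j₃ <;>
    simp only [Fin.append_left, Fin.append_right, abs_zero, zero_le_one, true_or, and_self]
    exact hK i₁ i₂ i₃ μ hμ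

/-- **The pump dictionary commutes with zero-padding.**  Pulling back the padded `Option (Fin 3)`-encoded table to Tao's
shift set gives the padding of the pulled-back table. [elementary] -/
theorem pullback_pad_comm (coeff : Fin m → Fin m → Fin m → Option (Fin 3) → ℝ) :
    (fun (j₁ j₂ j₃ : Fin (m + k)) (μ : ℤ × ℤ × ℤ) =>
      if μ = (0, 0, 0) then
        (Fin.append (fun i₁ : Fin m => Fin.append (fun i₂ : Fin m => Fin.append (coeff i₁ i₂)
            (fun (_ : Fin k) (_ : Option (Fin 3)) => (0 : ℝ)))
          (fun (_ : Fin k) (_ : Fin (m + k)) (_ : Option (Fin 3)) => (0 : ℝ)))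
          (fun (_ : Fin k) (_ : Fin (m + k)) (_ : Fin (m + k)) (_ : Option (Fin 3)) => (0 : ℝ))) j₁ j₂ j₃ none
      else if μ = (1, 0, 0) then
        (Fin.append (fun i₁ : Fin m => Fin.append (fun i₂ : Fin m => Fin.append (coeff i₁ i₂)
            (fun (_ : Fin k) (_ : Option (Fin 3)) => (0 : ℝ)))
          (fun (_ : Fin k) (_ : Fin (m + k)) (_ : Option (Fin 3)) => (0 : ℝ)))
          (fun (_ : Fin k) (_ : Fin (m + k)) (_ : Fin (m + k)) (_ : Option (Fin 3)) => (0 : ℝ))) j₁ j₂ j₃ (some 0)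
      else if μ = (0, 1, 0) then
        (Fin.append (fun i₁ : Fin m => Fin.append (fun i₂ : Fin m => Fin.append (coeff i₁ i₂)
            (fun (_ : Fin k) (_ : Option (Fin 3)) => (0 : ℝ)))
          (fun (_ : Fin k) (_ : Fin (m + k)) (_ : Option (Fin 3)) => (0 : ℝ)))
          (fun (_ : Fin k) (_ : Fin (m + k)) (_ : Fin (m + k)) (_ : Option (Fin 3)) => (0 : ℝ))) j₁ j₂ j₃ (some 1)
      else if μ = (0, 0, 1) then
        (Fin.append (fun i₁ : Fin m => Fin.append (fun i₂ : Fin m => Fin.append (coeff i₁ i₂)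
            (fun (_ : Fin k) (_ : Option (Fin 3)) => (0 : ℝ)))
          (fun (_ : Fin k) (_ : Fin (m + k)) (_ : Option (Fin 3)) => (0 : ℝ)))
          (fun (_ : Fin k) (_ : Fin (m + k)) (_ : Fin (m + k)) (_ : Option (Fin 3)) => (0 : ℝ))) j₁ j₂ j₃ (some 2)
      else 0) =
    Fin.append (fun i₁ : Fin m => Fin.append (fun i₂ : Fin m => Fin.append
        (fun (i₃ : Fin m) (μ : ℤ × ℤ × ℤ) =>
          if μ = (0, 0, 0) then coeff i₁ i₂ i₃ none
          else if μ = (1, 0, 0) then coeff i₁ i₂ i₃ (some 0)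
          else if μ = (0, 1, 0) then coeff i₁ i₂ i₃ (some 1)
          else if μ = (0, 0, 1) then coeff i₁ i₂ i₃ (some 2) else 0)
        (fun (_ : Fin k) (_ : ℤ × ℤ × ℤ) => (0 : ℝ)))
      (fun (_ : Fin k) (_ : Fin (m + k)) (_ : ℤ × ℤ × ℤ) => (0 : ℝ)))
      (fun (_ : Fin k) (_ : Fin (m + k)) (_ : Fin (m + k)) (_ : ℤ × ℤ × ℤ) => (0 : ℝ)) := by
  funext j₁ j₂ j₃ μ
  refine Fin.addCases (fun i₁ => ?_) (fun l₁ => ?_) j₁ <;>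
  refine Fin.addCases (fun i₂ => ?_) (fun l₂ => ?_) j₂ <;>
  refine Fin.addCases (fun i₃ => ?_) (fun l₃ => ?_) j₃ <;>
  simp only [Fin.append_left, Fin.append_right] <;>
  split_ifs <;> rfl

end Summit.NavierStokesRegularity.NavierStokesRegularity.Theorems.WakeRatchetCircuitPumpPadClass

end
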